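import Literature.AlgebraicGeometry.RelativeSpec.SubringSpecLift
import Mathlib.CategoryTheory.Endomorphism
import HarnessLib

/-!
# The relative spectrum of a quasi-coherent subalgebra of `f_* 𝒪_X`, III: automorphisms

Continuation of `Literature.AlgebraicGeometry.RelativeSpec.SubringSpec` / `SubringSpecLift`. For a
subring datum `D` for a qcqs morphism `f : X ⟶ Y` (subrings `D.ring U ⊆ Γ(X, f⁻¹U)` forming a
quasi-coherent `𝒪_Y`-subalgebra `𝒜` of `f_* 𝒪_X`, relative spectrum `D.spec = Spec_Y 𝒜`) we make
**endomorphisms of the `𝒪_Y`-algebra `𝒜` act on `Spec_Y 𝒜`** (functoriality of the relative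
spectrum in the algebra, Stacks 01LQ; EGA II (1.2.7), (1.3.1)):

* `SubringDatum.ιSpec`, `inclApp`, `ι_toSpec`, `ιSpec_fromSpec` — the charts
  `Spec (D.ring U) ↪ Spec_Y 𝒜` and the inclusions `D.ring U ⊆ Γ(X, f⁻¹U)` in a fixed syntactic
  form (sources `Spec (D.diagram.obj (op U))`), so that compositions along the charts rewrite;
* `SubringDatum.Endo D` — a family of ring endomorphisms of the `D.ring U`, `U ⊆ Y` affine open,
  commuting with the restriction maps and fixing the image of `Γ(Y, U)` (an endomorphism of the
  `𝒪_Y`-algebra `𝒜`, recorded on affine opens only); `Endo.id`, `Endo.comp`;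
* `SubringDatum.specMap σ : D.spec ⟶ D.spec` — the induced `Y`-endomorphism of `Spec_Y 𝒜`
  (`colimMap` of the natural transformation `U ↦ Spec (σ_U)` of the gluing diagram
  `U ↦ Spec (D.ring U)`), with `ι_specMap` (on the chart over `U` it is `Spec (σ_U)`),
  `specMap_fromSpec` (it lies over `Y`), `specMap_id`, `specMap_comp` (contravariant
  functoriality: `Spec` reverses composition);
* `SubringDatum.toAut` — a left action `g ↦ σ_g` of a group `G` on `𝒜` gives
  `G →* Aut (Spec_Y 𝒜)`, `g ↦ Spec(σ_{g⁻¹})`, over `Y` (`toAut_hom_fromSpec`);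
* `SubringDatum.comp_toSpec_eq_toSpec_specMap` — **equivariance of `X ⟶ Spec_Y 𝒜`**: if
  `e : X ⟶ X` is a morphism over `Y` and `σ` is the restriction of `e^*` to the `D.ring U`, then
  `e ≫ toSpec = toSpec ≫ specMap σ`.

The case in view: a finite group acting on an integral `X` over `Y` and preserving a
quasi-coherent subalgebra of `f_* 𝒪_X` (e.g. `𝒪 ∩ M` for a stable subfield `M` of the function
field) acts on its relative spectrum, equivariantly for `X → Spec_Y 𝒜` (de Jong 1997, 5.3: the
action on the infinitesimal quotients of a Galois alteration).

## References

* [StacksProject, Tag 01LQ] (relative spectrum; functoriality in the algebra).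
* A. Grothendieck, EGA II, (1.2.7), (1.3.1).
* Mathlib, `Mathlib/AlgebraicGeometry/Normalization.lean` (the gluing pattern, via `SubringSpec`).

## Design

`D.spec` is the colimit of the locally directed diagram `U ↦ Spec (D.ring U)` on the small affine
Zariski site of `Y` (Mathlib `relativeGluingData`), so an endomorphism of the diagram acts by
`Limits.colimMap`; all identities are checked chart by chart with `colimit.hom_ext` and
`ι_colimMap`. Everything is proved; the `def`s are constructions with bodies; no named facts.
-/

noncomputable section

universe u

open CategoryTheory Limits AlgebraicGeometry

namespace Literature.AlgebraicGeometry.RelativeSpec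

namespace SubringDatum

open Scheme.AffineZariskiSite

variable {X Y : Scheme.{u}} {f : X ⟶ Y} (D : SubringDatum f)

/-! ### Endomorphisms of a subring datum -/

/-- An **endomorphism of the subring datum `D` over `Y`**: ring endomorphisms `σ_U` of the
`D.ring U`, `U ⊆ Y` affine open, commuting with the restriction maps `D.ring U → D.ring V`
(`V ≤ U` affine) and fixing the image of `Γ(Y, U)` — i.e. an endomorphism of the quasi-coherent
`𝒪_Y`-algebra `U ↦ D.ring U`, recorded on the affine opens (which is all the relative spectrum
sees). [folklore] -/
structure Endo where
  /-- The ring endomorphism of `D.ring U` over the affine open `U`. -/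
  toFun (U : Y.affineOpens) : D.ring U.1 →+* D.ring U.1
  /-- Compatibility with restriction to a smaller affine open. -/
  map_apply {U V : Y.affineOpens} (i : V.1 ≤ U.1) (x : D.ring U.1) :
    D.diagram.map (homOfLE i).op (toFun U x) = toFun V (D.diagram.map (homOfLE i).op x)
  /-- The image of `Γ(Y, U)` is fixed. -/
  apply_app (U : Y.affineOpens) (a : Γ(Y, U.1)) :
    toFun U (D.diagramMap.app (.op U.1) a) = D.diagramMap.app (.op U.1) a

namespace Endo

variable {D}

/-- The identity endomorphism. [folklore] -/
protected def id : D.Endo where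
  toFun _ := RingHom.id _
  map_apply _ _ := rfl
  apply_app _ _ := rfl

/-- Composition of endomorphisms: `(σ.comp τ)_U = σ_U ∘ τ_U`. [folklore] -/
protected def comp (σ τ : D.Endo) : D.Endo where
  toFun U := (σ.toFun U).comp (τ.toFun U)
  map_apply i x := by
    change D.diagram.map (homOfLE i).op (σ.toFun _ (τ.toFun _ x)) =
      σ.toFun _ (τ.toFun _ (D.diagram.map (homOfLE i).op x))
    rw [σ.map_apply, τ.map_apply]
  apply_app U a := by
    change σ.toFun U (τ.toFun U _) = _
    rw [τ.apply_app, σ.apply_app]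

/-- Unfolding `Endo.id`. [folklore] -/
@[simp]
theorem id_toFun (U : Y.affineOpens) : (Endo.id : D.Endo).toFun U = RingHom.id _ := rfl

/-- Unfolding `Endo.comp`. [folklore] -/
@[simp]
theorem comp_toFun (σ τ : D.Endo) (U : Y.affineOpens) :
    (σ.comp τ).toFun U = (σ.toFun U).comp (τ.toFun U) := rfl

/-- Two endomorphisms agreeing on every affine open are equal. [folklore] -/
@[ext]
theorem ext {σ τ : D.Endo} (h : ∀ U, σ.toFun U = τ.toFun U) : σ = τ := by
  cases σ; cases τ; congr; exact funext h

end Endo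

/-! ### Canonical forms of the charts

The gluing diagram of `D.spec` is `U ↦ Spec (D.diagram.obj (op U))` on the affine opens; we fix
this syntactic form of the charts (`ιSpec`) and of the inclusions `D.ring U ⊆ Γ(X, f⁻¹U)`
(`inclApp`) so that compositions rewrite smoothly. -/

variable [QuasiCompact f] [QuasiSeparated f]

/-- The chart `Spec (D.ring U) ⟶ Spec_Y(D.ring)` over the affine open `U` (this is
`D.openCover.f U`, with its source written as `Spec (D.diagram.obj (op U))`). [folklore] -/
def ιSpec (U : Y.affineOpens) : Spec (D.diagram.obj (.op U.1)) ⟶ D.spec := D.openCover.f U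

/-- `ιSpec U` is the chart `D.openCover.f U` (definitional). [folklore] -/
theorem ιSpec_def (U : Y.affineOpens) : D.ιSpec U = D.openCover.f U := rfl

/-- The charts `ιSpec U` are open immersions. [folklore] -/
instance isOpenImmersion_ιSpec (U : Y.affineOpens) : IsOpenImmersion (D.ιSpec U) :=
  inferInstanceAs (IsOpenImmersion (D.openCover.f U))

/-- On the chart over an affine `U`, `fromSpec` is `Spec (Γ(Y, U) → D.ring U)` followed by
`U ↪ Y` (`ι_fromSpec` in canonical form). [folklore] -/
@[reassoc]
theorem ιSpec_fromSpec (U : Y.affineOpens) :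
    D.ιSpec U ≫ D.fromSpec = Spec.map (D.diagramMap.app (.op U.1)) ≫ U.2.fromSpec :=
  D.ι_fromSpec U

omit [QuasiCompact f] [QuasiSeparated f] in
/-- The inclusion `D.ring U ⊆ Γ(X, f⁻¹U)` as a morphism `D.diagram.obj (op U) ⟶ Γ(X, f⁻¹U)`
(this is `D.inclusion.app (op U)`). [folklore] -/
def inclApp (U : Y.affineOpens) : D.diagram.obj (.op U.1) ⟶ Γ(X, f ⁻¹ᵁ U.1) :=
  D.inclusion.app (.op U.1)

omit [QuasiCompact f] [QuasiSeparated f] in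
/-- `inclApp U` on elements is the coercion `D.ring U → Γ(X, f⁻¹U)`. [folklore] -/
@[simp]
theorem inclApp_apply (U : Y.affineOpens) (s : D.ring U.1) : D.inclApp U s = (s : Γ(X, f ⁻¹ᵁ U.1)) :=
  rfl

/-- `toSpec` on the open `f⁻¹U`, `U` affine: `f⁻¹U → Spec Γ(X, f⁻¹U) → Spec (D.ring U) ↪ Spec_Y`
(`ι_lift` for the inclusions, in canonical form). [folklore] -/
@[reassoc]
theorem ι_toSpec (U : Y.affineOpens) :
    (f ⁻¹ᵁ U.1).ι ≫ D.toSpec = (f ⁻¹ᵁ U.1).toSpecΓ ≫ Spec.map (D.inclApp U) ≫ D.ιSpec U :=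
  D.ι_lift f D.inclusion U

/-! ### The induced endomorphism of the relative spectrum -/

omit [QuasiCompact f] [QuasiSeparated f] in
/-- The component of an endomorphism `σ` over the affine `U`, as a morphism
`D.diagram.obj (op U) ⟶ D.diagram.obj (op U)` of `CommRingCat`. [folklore] -/
def Endo.app (σ : D.Endo) (U : Y.affineOpens) : D.diagram.obj (.op U.1) ⟶ D.diagram.obj (.op U.1) :=
  CommRingCat.ofHom (σ.toFun U)

omit [QuasiCompact f] [QuasiSeparated f] in
/-- `σ.app U` on elements is `σ_U`. [folklore] -/
@[simp]
theorem Endo.app_apply (σ : D.Endo) (U : Y.affineOpens) (x : D.ring U.1) :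
    Endo.app D σ U x = σ.toFun U x :=
  rfl

set_option backward.isDefEq.respectTransparency false in
/-- The natural transformation `U ↦ Spec (σ_U)` of the gluing diagram `U ↦ Spec (D.ring U)`
induced by an endomorphism `σ` of the datum. [folklore] -/
def Endo.natTrans (σ : D.Endo) : D.glueData.functor ⟶ D.glueData.functor where
  app U := Spec.map (Endo.app D σ U)
  naturality {U V} i := by
    change Spec.map (D.diagram.map ((toOpensFunctor Y).map i).op) ≫ Spec.map (Endo.app D σ V) =
      Spec.map (Endo.app D σ U) ≫ Spec.map (D.diagram.map ((toOpensFunctor Y).map i).op)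
    rw [← Spec.map_comp, ← Spec.map_comp]
    congr 1
    ext x
    change D.diagram.map (homOfLE (toOpens_mono i.le)).op (σ.toFun V x) =
      σ.toFun U (D.diagram.map (homOfLE (toOpens_mono i.le)).op x)
    exact σ.map_apply (toOpens_mono i.le) x

/-- **The endomorphism of `Spec_Y(D.ring)` induced by an endomorphism `σ` of the datum**: glued
from the `Spec (σ_U) : Spec (D.ring U) → Spec (D.ring U)` (functoriality of the relative spectrum
in the quasi-coherent algebra, Stacks 01LQ). [folklore] -/
def specMap (σ : D.Endo) : D.spec ⟶ D.spec :=
  colimMap (Endo.natTrans D σ)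

/-- On the chart over an affine `U`, `specMap σ` is `Spec (σ_U)`. [folklore] -/
@[reassoc]
theorem ι_specMap (σ : D.Endo) (U : Y.affineOpens) :
    D.ιSpec U ≫ D.specMap σ = Spec.map (Endo.app D σ U) ≫ D.ιSpec U :=
  ι_colimMap _ _

/-- `specMap σ` is a morphism over `Y`: `specMap σ ≫ fromSpec = fromSpec` (as `σ` fixes the image
of `Γ(Y, U)`). [folklore] -/
@[reassoc (attr := simp)]
theorem specMap_fromSpec (σ : D.Endo) : D.specMap σ ≫ D.fromSpec = D.fromSpec := by
  refine Scheme.Cover.hom_ext D.openCover _ _ fun U ↦ ?_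
  change D.ιSpec U ≫ D.specMap σ ≫ D.fromSpec = D.ιSpec U ≫ D.fromSpec
  rw [← Category.assoc, D.ι_specMap σ U, Category.assoc, D.ιSpec_fromSpec U,
    ← Spec.map_comp_assoc]
  congr 2
  ext a
  exact σ.apply_app U a

/-- `specMap` of the identity is the identity. [folklore] -/
@[simp]
theorem specMap_id : D.specMap Endo.id = 𝟙 D.spec := by
  refine Scheme.Cover.hom_ext D.openCover _ _ fun U ↦ ?_
  change D.ιSpec U ≫ D.specMap Endo.id = D.ιSpec U ≫ 𝟙 D.spec
  rw [D.ι_specMap Endo.id U, Category.comp_id]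
  change Spec.map (CommRingCat.ofHom (RingHom.id _)) ≫ _ = _
  rw [CommRingCat.ofHom_id, Spec.map_id, Category.id_comp]

/-- `specMap` reverses composition: `specMap (σ ∘ τ) = specMap σ ≫ specMap τ` (`Spec` is
contravariant). [folklore] -/
theorem specMap_comp (σ τ : D.Endo) : D.specMap (σ.comp τ) = D.specMap σ ≫ D.specMap τ := by
  refine Scheme.Cover.hom_ext D.openCover _ _ fun U ↦ ?_
  change D.ιSpec U ≫ D.specMap (σ.comp τ) = D.ιSpec U ≫ D.specMap σ ≫ D.specMap τ
  rw [D.ι_specMap (σ.comp τ) U, ← Category.assoc, D.ι_specMap σ U, Category.assoc,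
    D.ι_specMap τ U, ← Spec.map_comp_assoc]
  rfl

/-- `specMap σ` on points of the chart over `U`. [folklore] -/
theorem specMap_apply_ιSpec (σ : D.Endo) (U : Y.affineOpens) (q : Spec (D.diagram.obj (.op U.1))) :
    D.specMap σ (D.ιSpec U q) = D.ιSpec U (Spec.map (Endo.app D σ U) q) := by
  rw [← Scheme.Hom.comp_apply, D.ι_specMap σ U, Scheme.Hom.comp_apply]

/-! ### Group actions on the datum act on the relative spectrum -/

section Group

variable {G : Type*} [Group G] (act : G → D.Endo) (act_one : act 1 = Endo.id)
  (act_mul : ∀ g h : G, act (g * h) = (act g).comp (act h))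

include act_one act_mul in
/-- `specMap (act g⁻¹) ≫ specMap (act g) = 𝟙`. [folklore] -/
theorem specMap_inv_comp (g : G) : D.specMap (act g⁻¹) ≫ D.specMap (act g) = 𝟙 _ := by
  rw [← specMap_comp, ← act_mul, inv_mul_cancel, act_one, specMap_id]

include act_one act_mul in
/-- `specMap (act g) ≫ specMap (act g⁻¹) = 𝟙`. [folklore] -/
theorem specMap_comp_inv (g : G) : D.specMap (act g) ≫ D.specMap (act g⁻¹) = 𝟙 _ := by
  rw [← specMap_comp, ← act_mul, mul_inv_cancel, act_one, specMap_id]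

/-- **A left action of `G` on the datum acts on `Spec_Y(D.ring)`**: `g ↦ Spec (σ_{g⁻¹})` is a
homomorphism `G → Aut (Spec_Y(D.ring))` (the inverse makes the contravariant `Spec` covariant;
with this convention `X → Spec_Y(D.ring)` is equivariant when `σ_g = (g⁻¹)^*`, see
`comp_toSpec_eq_toSpec_specMap`). [folklore] -/
def toAut : G →* Aut D.spec where
  toFun g :=
    { hom := D.specMap (act g⁻¹)
      inv := D.specMap (act g)
      hom_inv_id := D.specMap_inv_comp act act_one act_mul g
      inv_hom_id := D.specMap_comp_inv act act_one act_mul g }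
  map_one' := by
    ext : 1
    change D.specMap (act 1⁻¹) = 𝟙 _
    rw [inv_one, act_one, specMap_id]
  map_mul' g h := by
    ext : 1
    change D.specMap (act (g * h)⁻¹) = D.specMap (act h⁻¹) ≫ D.specMap (act g⁻¹)
    rw [mul_inv_rev, act_mul, specMap_comp]

/-- Unfolding `toAut`: `(toAut g).hom = specMap (act g⁻¹)`. [folklore] -/
@[simp]
theorem toAut_hom (g : G) : (D.toAut act act_one act_mul g).hom = D.specMap (act g⁻¹) := rfl

/-- Unfolding `toAut`: `(toAut g).inv = specMap (act g)`. [folklore] -/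
@[simp]
theorem toAut_inv (g : G) : (D.toAut act act_one act_mul g).inv = D.specMap (act g) := rfl

/-- The action on `Spec_Y(D.ring)` is over `Y`. [folklore] -/
@[reassoc (attr := simp)]
theorem toAut_hom_fromSpec (g : G) :
    (D.toAut act act_one act_mul g).hom ≫ D.fromSpec = D.fromSpec :=
  D.specMap_fromSpec _

end Group

/-! ### Equivariance of `X ⟶ Spec_Y(D.ring)` -/

omit [QuasiCompact f] [QuasiSeparated f] in
/-- A morphism `e : X ⟶ X` over `Y` preserves the preimages `f⁻¹U`. [folklore] -/
theorem _root_.Literature.AlgebraicGeometry.RelativeSpec.preimage_le_preimage_preimage_of_comp_eq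
    (e : X ⟶ X) (he : e ≫ f = f) (U : Y.Opens) : f ⁻¹ᵁ U ≤ e ⁻¹ᵁ (f ⁻¹ᵁ U) := by
  rw [← Scheme.Hom.comp_preimage, he]

set_option backward.isDefEq.respectTransparency false in
/-- **Equivariance of `toSpec`.** Let `e : X ⟶ X` be a morphism over `Y` and `σ` an endomorphism
of the datum which on every `D.ring U` is the pull-back `e^* : Γ(X, f⁻¹U) → Γ(X, f⁻¹U)`. Then
`e ≫ toSpec = toSpec ≫ specMap σ` (on `f⁻¹U`, `U` affine, both sides are
`f⁻¹U → Spec Γ(X, f⁻¹U) → Spec (D.ring U) ↪ Spec_Y`, through `e^* ∘ incl = incl ∘ σ_U`).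
[folklore] -/
theorem comp_toSpec_eq_toSpec_specMap (e : X ⟶ X) (he : e ≫ f = f) (σ : D.Endo)
    (hσ : ∀ (U : Y.affineOpens) (s : D.ring U.1), ((σ.toFun U s : D.ring U.1) : Γ(X, f ⁻¹ᵁ U.1)) =
      e.appLE (f ⁻¹ᵁ U.1) (f ⁻¹ᵁ U.1) (preimage_le_preimage_preimage_of_comp_eq e he U.1) s) :
    e ≫ D.toSpec = D.toSpec ≫ D.specMap σ := by
  refine Scheme.Cover.hom_ext (X.openCoverOfIsOpenCover _
    (.comap (iSup_affineOpens_eq_top Y) f.base.1)) _ _ fun U ↦ ?_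
  change (f ⁻¹ᵁ U.1).ι ≫ e ≫ D.toSpec = (f ⁻¹ᵁ U.1).ι ≫ D.toSpec ≫ D.specMap σ
  have hle : f ⁻¹ᵁ U.1 ≤ e ⁻¹ᵁ (f ⁻¹ᵁ U.1) := preimage_le_preimage_preimage_of_comp_eq e he U.1
  rw [← Scheme.Hom.resLE_comp_ι_assoc e hle, D.ι_toSpec U,
    ← Scheme.Opens.toSpecΓ_SpecMap_appLE_assoc, ← Spec.map_comp_assoc, D.ι_toSpec_assoc U,
    D.ι_specMap σ U, ← Spec.map_comp_assoc]
  congr 3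
  ext s
  exact (hσ U s).symm

end SubringDatum

end Literature.AlgebraicGeometry.RelativeSpec

end
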